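import Literature.MathematicalPhysics.QuantumFieldTheory.Balaban1983to89.B9Eq359CubeKernelsKnitAtOne
import Literature.MathematicalPhysics.QuantumFieldTheory.Balaban1983to89.B9Eq357CubeLetters

/-!
# `Balaban1983to89.B9Eq359KnitCubeQDiffAtOne` — [Balaban1985BackgroundPropagators] (3.57)–(3.59) pp. 401–402 AT THE CUBE KNIT LETTER `parKnitCubeY`, BASE `U = 1`:
# the two POINTWISE (3.59) sizes `‖(Q′_□(Ṽ) − Q′_□(1))λ(s)‖ ≤ C_q^K·α₁·Σ_z q′_□(s,z)‖λ(z)‖` and `‖(Q′*_□(Ṽ) − Q′*_□(1))ν(z)‖ ≤ C_q^K·α₁·Σ_s q′*_□(z,s)‖ν(s)‖` for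
# `Ṽ = e^{iηa}·1` under the own-level (3.37) — n06-l's (3.58) key estimate `norm_parKnitCubeY_mulY_one_sub_one_le` through r05's letter-Lipschitz lemma
# `norm_trLiftY_sub_apply_le_of_Rclm`; these are the last displayed `A`-dependent binders (`hF ∕ hFs`) of ROAD (I)'s `cor35_CDir_cube₀ ∕ cor35_PCubeDY_cube₀ ∕
# hPP_dirC_cube₀` not already produced by n06-a's `gpDir_cube_at_field` (ROAD (I) U6g; seat dag-n06-c g33)

statement-level skeleton of published theorems with citation tags; proofs where landed; nothing here is a claim about the Yang–Mills mass gap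

## What this file does (mathematically)

[Balaban1985BackgroundPropagators] (3.57) p. 401: `Q′(U′U) = Q′(U) + F′₂(A)`, the contour variables of `Q′` «involve the gauge field variables U′_b, U_b for
b ⊂ B^j(y)»; (3.59) p. 402: `|(F′₂λ)(y)| ≤ O(1)α₁(Q̃′|λ|)(y)`.  At the cube sequence's knit letter (def-Y's `parKnitCubeY i □`, print's (3.40) legs of p. 397) and
the base `U = 1` (Cor. 3.5 p. 407) the transporter of `Q′_□(Ṽ)` from `z ∈ Δ(s)` to the corner of `s` is `U′(Γ^{(n)}_{c_s,z})` with ‖· − 1‖ ≤ 154(d+1)α₁ (n06-l);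
conjugation `X ↦ U′XU′⁻¹` then moves `X` by at most `5·154(d+1)α₁‖X‖ = C_q^K·α₁‖X‖` (r05 `norm_R_sub_self_le_of_small`), and r05's `norm_trLiftY_sub_apply_le_of_Rclm`
sums over the block: ★★ `norm_QpCubeY_parKnitCubeY_sub_one_apply_le`, ★★ `norm_QpsCubeY_parKnitCubeY_sub_one_apply_le` (the starred letter transports by the
inverse legs), and the `∀`-forms ★★★ `hF_parKnitCubeY` ∕ ★★★ `hFs_parKnitCubeY` under the own-level (3.37) on every block — literally the hypotheses `hF ∕ hFs` of
`B9Cor35CDirCubeNoLegHyp.cor35_CDir_cube₀` etc. with `Cq := CqK d`, at `Ṽ = mulY i (fluct η a) 1` (`= cutCfgS i Ω₀(□) η A` for `a = cutFldS i Ω₀(□) A`).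

## Status

Printed-statement pass + proof body (proof-backed; a port in the tree's vocabulary): [Balaban1985BackgroundPropagators] (3.57)–(3.59) pp. 401–402, (3.37) p. 396,
Cor. 3.5 p. 407, re-read 2026-08-31.  Honest label: the pointwise (3.59) sizes at the knit cube letter for matrix algebras `𝔸 = M_N(ℂ)`, base `U = 1`, in
p06's small-field window (the hypotheses of n06-l's key estimate, displayed verbatim).  Node N06 of the `pub-ymgap` DAG is NOT discharged here and the Yang–Mills
mass gap is NOT proved here.  NEW file; nothing landed is modified.  No `sorry`, no `axiom`, no `instance`, no `notation`.  Net new unproved facts: 0.  Cell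
`pub-ymgap` (HUMAN RULING D-0062), node N06 [B9], seat `pub-ymgap-dag-n06-c` (g33), 2026-08-31.
RELATED, NOT DUPLICATED (searched 2026-08-31: `rg 'norm_QpCubeY_parKnitCubeY_sub_one_apply_le|hF_parKnitCubeY|hFs_parKnitCubeY'` = ∅): r05 `B9Eq357CubeLetters.norm_QpCubeY_sub_one_apply_le`
(the same at the taxicab letter `parSymY`), n06-l `B9Eq359CubeKernelsKnitAtOne.norm_kFCubeY_parKnitCubeY_one_le` (the KERNEL letters `kF ∕ sF` at `parKnitCubeY`;
this file is the AVERAGING letters' twin, same constant `C_q^K`).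
-/

noncomputable section

namespace Literature.MathematicalPhysics.QuantumFieldTheory.Balaban1983to89.B9Eq359KnitCubeQDiffAtOne

open B7Prop2Explicit (C0 c2')
open B7Prop3Flat (c3)
open B6Geom246MultiLevelBoxL0 (blkOf)
open B6GlobalChartV1 (PV toBox)
open B6KLevelCensusIndexV1 (KIdx kGeo)
open B6Cover236MultiLevelBlocks (cubes)
open B9Eq39Adjoint (R R_one fluct)
open B9Eq360DeltaPrimeAY (Rclm Rclm_apply mulY AfldY)
open B9Eq360DeltaPrimeACubeY (blkCubeY blkCubeY_apply)
open B9CubeLettersOpsL0 (cubeFamY)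
open B9CubeLettersBondOpsL0 (BlkCubeY blkCornerCubeY qpKc qpsKc qpTc QpCubeY QpsCubeY)
open B9Eq357CubeLetters (blkOf_of_qpKc_ne_zero blkOf_of_qpsKc_ne_zero norm_trLiftY_sub_apply_le_of_Rclm)
open B9Cor36GpCubeEntriesAtV (norm_R_sub_self_le_of_small)
open B9Eq359CubeKernelsKnitAtOne (CqK norm_parKnitCubeY_mulY_one_sub_one_le norm_inv_sub_one_le)
open Node00 (SiteY CfgY toKT)
open Node00.OpsYCubeKnitPar (parKnitCubeY parKnitCubeY_one parKnitCubeY_inv)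

variable {d ℓ : ℕ} {hd : 1 ≤ d + 1} {hL : Odd (ℓ + 1) ∧ 1 < ℓ + 1} {b₀ b₁ : ℝ}

section Main

open scoped Matrix Matrix.Norms.L2Operator

variable {N : ℕ} [Nonempty (Fin N)] (i : KIdx d ℓ hd hL b₀ b₁) (c : ↥(cubes (toKT i).D.toDomains))

/-- ★ **THE CONJUGATION LETTER OF A KNIT LEG IS WITHIN `C_q^K·α₁` OF THE IDENTITY** (operator norm): for `u = U′(Γ^{(n)}_{c_s,w})`, `w ∈ Δ(s)`, under the own-level (3.37)
on `s`, `‖R(u) − R(1)‖ ≤ C_q^K·α₁` and the same for `u⁻¹`. [cite: Balaban1985BackgroundPropagators, (3.58) p.402, (3.37) p.396, Cor. 3.5 p.407] -/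
theorem norm_Rclm_parKnitCubeY_sub_le
    {α₀' : ℝ} (hα' : 0 < α₀') (hα3 : C0 (d + 1) * α₀' ≤ 1 / 3) (hα4 : 4 * α₀' ≤ c2' (d + 1) (ℓ + 1))
    {η α₁ : ℝ} (hη : 0 ≤ η) (hα₁ : 0 ≤ α₁)
    (hsmall : Real.exp (4 * (800 * (((d + 1 : ℕ) : ℝ) + 1) ^ 2 * (((d + 1 : ℕ) : ℝ) + 4)) * α₀')
      * (1 + 8 * (131072 * (((d + 1 : ℕ) : ℝ) + 1) ^ 2) * α₁) ≤ 2)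
    (hc₃ : 2 * α₁ ≤ c3 (d + 1) (ℓ + 1)) (hsm : 4096 * ((d + 1 : ℕ) : ℝ) * α₁ ≤ 1)
    (a : AfldY (Matrix (Fin N) (Fin N) ℂ) i) (s : BlkCubeY i c)
    (ha : ∀ (ν : Fin (d + 1)) (v : Site (PV d ℓ i.m i.K hd hL) 0), blkOf (cubeFamY i c).toDomains (toBox i.hN v) = s →
      η * ‖a ν v‖ ≤ α₁ * ((((ℓ + 1) ^ s.1.1 : ℕ) : ℝ))⁻¹)
    {w : SiteY i} (hw : blkOf (cubeFamY i c).toDomains w = s) :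
    ‖Rclm (parKnitCubeY i c (mulY i (fluct η a) (fun _ _ => 1)) (blkCornerCubeY i c s) w) - Rclm (1 : (Matrix (Fin N) (Fin N) ℂ)ˣ)‖ ≤ CqK d * α₁ ∧
      ‖Rclm (parKnitCubeY i c (mulY i (fluct η a) (fun _ _ => 1)) (blkCornerCubeY i c s) w)⁻¹ - Rclm (1 : (Matrix (Fin N) (Fin N) ℂ)ˣ)‖ ≤ CqK d * α₁ := by
  letI : CStarAlgebra (Matrix (Fin N) (Fin N) ℂ) := {}
  set u := parKnitCubeY i c (mulY i (fluct η a) (fun _ _ => 1)) (blkCornerCubeY i c s) w with hu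
  set ε : ℝ := 154 * ((d : ℝ) + 1) * α₁ with hε
  have hε0 : 0 ≤ ε := by positivity
  have hd1 : ((d + 1 : ℕ) : ℝ) = (d : ℝ) + 1 := by push_cast; ring
  have hε2 : ε ≤ 1 / 4 := by rw [hd1] at hsm; rw [hε]; nlinarith
  have h1 : ‖(u : Matrix (Fin N) (Fin N) ℂ) - 1‖ ≤ ε := norm_parKnitCubeY_mulY_one_sub_one_le i c hα' hα3 hα4 hη hα₁ hsmall hc₃ hsm a s ha hw
  have h2 : ‖((u⁻¹ : (Matrix (Fin N) (Fin N) ℂ)ˣ) : Matrix (Fin N) (Fin N) ℂ) - 1‖ ≤ 2 * ε := norm_inv_sub_one_le u (by linarith) h1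
  have hC : 0 ≤ CqK d * α₁ := by unfold CqK; positivity
  have hfin : 5 * ε = CqK d * α₁ := by rw [hε]; unfold CqK; ring
  constructor
  · refine ContinuousLinearMap.opNorm_le_bound _ hC fun X => ?_
    rw [sub_apply, Rclm_apply, Rclm_apply, R_one, ← hfin]
    exact norm_R_sub_self_le_of_small u hε0 hε2 (h1.trans (by linarith)) h2 X
  · refine ContinuousLinearMap.opNorm_le_bound _ hC fun X => ?_
    rw [sub_apply, Rclm_apply, Rclm_apply, R_one, ← hfin]
    exact norm_R_sub_self_le_of_small u⁻¹ hε0 hε2 h2 (by rw [inv_inv]; exact h1.trans (by linarith)) X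

/-- ★★ **(3.59) FOR `Q′_□` AT THE KNIT LETTER, BASE `U = 1`, POINTWISE**: `‖(Q′_□(Ṽ)λ − Q′_□(1)λ)(s)‖ ≤ C_q^K·α₁·Σ_z q′_□(s,z)‖λ(z)‖`, `Ṽ = e^{iηa}·1`, under the
own-level (3.37) on `s`. [cite: Balaban1985BackgroundPropagators, (3.57) p.401, (3.59) p.402, (3.37) p.396, Cor. 3.5 p.407, p.409 l.3–5] -/
theorem norm_QpCubeY_parKnitCubeY_sub_one_apply_le
    {α₀' : ℝ} (hα' : 0 < α₀') (hα3 : C0 (d + 1) * α₀' ≤ 1 / 3) (hα4 : 4 * α₀' ≤ c2' (d + 1) (ℓ + 1))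
    {η α₁ : ℝ} (hη : 0 ≤ η) (hα₁ : 0 ≤ α₁)
    (hsmall : Real.exp (4 * (800 * (((d + 1 : ℕ) : ℝ) + 1) ^ 2 * (((d + 1 : ℕ) : ℝ) + 4)) * α₀')
      * (1 + 8 * (131072 * (((d + 1 : ℕ) : ℝ) + 1) ^ 2) * α₁) ≤ 2)
    (hc₃ : 2 * α₁ ≤ c3 (d + 1) (ℓ + 1)) (hsm : 4096 * ((d + 1 : ℕ) : ℝ) * α₁ ≤ 1)
    (a : AfldY (Matrix (Fin N) (Fin N) ℂ) i) (s : BlkCubeY i c)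
    (ha : ∀ (ν : Fin (d + 1)) (v : Site (PV d ℓ i.m i.K hd hL) 0), blkOf (cubeFamY i c).toDomains (toBox i.hN v) = s →
      η * ‖a ν v‖ ≤ α₁ * ((((ℓ + 1) ^ s.1.1 : ℕ) : ℝ))⁻¹)
    (lam : SiteY i → Matrix (Fin N) (Fin N) ℂ) :
    ‖(QpCubeY i c (parKnitCubeY i c) (mulY i (fluct η a) (fun _ _ => 1)) lam - QpCubeY i c (parKnitCubeY i c) (fun _ _ => 1) lam) s‖ ≤
      CqK d * α₁ * ∑ z, |qpKc i c s z| * ‖lam z‖ := by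
  have h := norm_trLiftY_sub_apply_le_of_Rclm (qpKc i c) (qpTc i c (parKnitCubeY i c) (mulY i (fluct η a) (fun _ _ => 1)))
    (qpTc i c (parKnitCubeY i c) (fun _ _ => 1)) lam s (τ := fun _ => CqK d * α₁) (fun z hz => by
      have e1 : qpTc i c (parKnitCubeY i c) (fun _ _ => (1 : (Matrix (Fin N) (Fin N) ℂ)ˣ)) s z = 1 := parKnitCubeY_one i c _ z
      rw [e1]
      exact (norm_Rclm_parKnitCubeY_sub_le i c hα' hα3 hα4 hη hα₁ hsmall hc₃ hsm a s ha (blkOf_of_qpKc_ne_zero i c hz)).1)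
  refine (le_of_eq rfl).trans (h.trans (le_of_eq ?_))
  rw [Finset.mul_sum]
  refine Finset.sum_congr rfl fun z _ => ?_
  ring

/-- ★★ **(3.59) FOR `Q′*_□` AT THE KNIT LETTER, BASE `U = 1`, POINTWISE**: `‖(Q′*_□(Ṽ)ν − Q′*_□(1)ν)(z)‖ ≤ C_q^K·α₁·Σ_s q′*_□(z,s)‖ν(s)‖` under the own-level (3.37) on the
block of `z` (the starred letter transports by the inverse legs). [cite: Balaban1985BackgroundPropagators, (3.59) p.402 («a similar expansion for the adjoint operator»), (3.24) p.394, (3.37) p.396] -/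
theorem norm_QpsCubeY_parKnitCubeY_sub_one_apply_le
    {α₀' : ℝ} (hα' : 0 < α₀') (hα3 : C0 (d + 1) * α₀' ≤ 1 / 3) (hα4 : 4 * α₀' ≤ c2' (d + 1) (ℓ + 1))
    {η α₁ : ℝ} (hη : 0 ≤ η) (hα₁ : 0 ≤ α₁)
    (hsmall : Real.exp (4 * (800 * (((d + 1 : ℕ) : ℝ) + 1) ^ 2 * (((d + 1 : ℕ) : ℝ) + 4)) * α₀')
      * (1 + 8 * (131072 * (((d + 1 : ℕ) : ℝ) + 1) ^ 2) * α₁) ≤ 2)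
    (hc₃ : 2 * α₁ ≤ c3 (d + 1) (ℓ + 1)) (hsm : 4096 * ((d + 1 : ℕ) : ℝ) * α₁ ≤ 1)
    (a : AfldY (Matrix (Fin N) (Fin N) ℂ) i) (z : SiteY i)
    (ha : ∀ (ν : Fin (d + 1)) (v : Site (PV d ℓ i.m i.K hd hL) 0),
      blkOf (cubeFamY i c).toDomains (toBox i.hN v) = blkOf (cubeFamY i c).toDomains z →
        η * ‖a ν v‖ ≤ α₁ * ((((ℓ + 1) ^ (blkOf (cubeFamY i c).toDomains z).1.1 : ℕ) : ℝ))⁻¹)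
    (nu : BlkCubeY i c → Matrix (Fin N) (Fin N) ℂ) :
    ‖(QpsCubeY i c (parKnitCubeY i c) (mulY i (fluct η a) (fun _ _ => 1)) nu - QpsCubeY i c (parKnitCubeY i c) (fun _ _ => 1) nu) z‖ ≤
      CqK d * α₁ * ∑ s, |qpsKc i c z s| * ‖nu s‖ := by
  have h := norm_trLiftY_sub_apply_le_of_Rclm (qpsKc i c) (fun z s => (qpTc i c (parKnitCubeY i c) (mulY i (fluct η a) (fun _ _ => 1)) s z)⁻¹)
    (fun z s => (qpTc i c (parKnitCubeY i c) (fun _ _ => 1) s z)⁻¹) nu z (τ := fun _ => CqK d * α₁) (fun s hs => by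
      have hzs := blkOf_of_qpsKc_ne_zero i c hs
      have e1 : qpTc i c (parKnitCubeY i c) (fun _ _ => (1 : (Matrix (Fin N) (Fin N) ℂ)ˣ)) s z = 1 := parKnitCubeY_one i c _ z
      rw [e1, inv_one]
      have ha' : ∀ (ν : Fin (d + 1)) (v : Site (PV d ℓ i.m i.K hd hL) 0), blkOf (cubeFamY i c).toDomains (toBox i.hN v) = s →
          η * ‖a ν v‖ ≤ α₁ * ((((ℓ + 1) ^ s.1.1 : ℕ) : ℝ))⁻¹ := fun ν v hv => by
        have h := ha ν v (hv.trans hzs.symm); rwa [hzs] at h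
      exact (norm_Rclm_parKnitCubeY_sub_le i c hα' hα3 hα4 hη hα₁ hsmall hc₃ hsm a s ha' hzs).2)
  refine (le_of_eq rfl).trans (h.trans (le_of_eq ?_))
  rw [Finset.mul_sum]
  refine Finset.sum_congr rfl fun s _ => ?_
  ring

/-- ★★★ **BINDER `hF` OF ROAD (I) AT THE KNIT LETTER**: under the own-level (3.37) on EVERY block, the `∀ s λ` form with `Cq := C_q^K`.
[cite: Balaban1985BackgroundPropagators, (3.57)–(3.59) pp.401–402, (3.37) p.396, Cor. 3.5 p.407, p.409 l.3–5] -/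
theorem hF_parKnitCubeY
    {α₀' : ℝ} (hα' : 0 < α₀') (hα3 : C0 (d + 1) * α₀' ≤ 1 / 3) (hα4 : 4 * α₀' ≤ c2' (d + 1) (ℓ + 1))
    {η α₁ : ℝ} (hη : 0 ≤ η) (hα₁ : 0 ≤ α₁)
    (hsmall : Real.exp (4 * (800 * (((d + 1 : ℕ) : ℝ) + 1) ^ 2 * (((d + 1 : ℕ) : ℝ) + 4)) * α₀')
      * (1 + 8 * (131072 * (((d + 1 : ℕ) : ℝ) + 1) ^ 2) * α₁) ≤ 2)
    (hc₃ : 2 * α₁ ≤ c3 (d + 1) (ℓ + 1)) (hsm : 4096 * ((d + 1 : ℕ) : ℝ) * α₁ ≤ 1)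
    (a : AfldY (Matrix (Fin N) (Fin N) ℂ) i)
    (ha : ∀ (s : BlkCubeY i c) (ν : Fin (d + 1)) (v : Site (PV d ℓ i.m i.K hd hL) 0), blkOf (cubeFamY i c).toDomains (toBox i.hN v) = s →
      η * ‖a ν v‖ ≤ α₁ * ((((ℓ + 1) ^ s.1.1 : ℕ) : ℝ))⁻¹) :
    ∀ (s : BlkCubeY i c) (lam : SiteY i → Matrix (Fin N) (Fin N) ℂ),
      ‖(QpCubeY i c (parKnitCubeY i c) (mulY i (fluct η a) (fun _ _ => 1)) lam - QpCubeY i c (parKnitCubeY i c) (fun _ _ => 1) lam) s‖ ≤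
        CqK d * α₁ * ∑ z, |qpKc i c s z| * ‖lam z‖ :=
  fun s lam => norm_QpCubeY_parKnitCubeY_sub_one_apply_le i c hα' hα3 hα4 hη hα₁ hsmall hc₃ hsm a s (ha s) lam

/-- ★★★ **BINDER `hFs` OF ROAD (I) AT THE KNIT LETTER**: the `∀ z ν` form. [cite: Balaban1985BackgroundPropagators, (3.59) p.402, (3.24) p.394, (3.37) p.396, Cor. 3.5 p.407] -/
theorem hFs_parKnitCubeY
    {α₀' : ℝ} (hα' : 0 < α₀') (hα3 : C0 (d + 1) * α₀' ≤ 1 / 3) (hα4 : 4 * α₀' ≤ c2' (d + 1) (ℓ + 1))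
    {η α₁ : ℝ} (hη : 0 ≤ η) (hα₁ : 0 ≤ α₁)
    (hsmall : Real.exp (4 * (800 * (((d + 1 : ℕ) : ℝ) + 1) ^ 2 * (((d + 1 : ℕ) : ℝ) + 4)) * α₀')
      * (1 + 8 * (131072 * (((d + 1 : ℕ) : ℝ) + 1) ^ 2) * α₁) ≤ 2)
    (hc₃ : 2 * α₁ ≤ c3 (d + 1) (ℓ + 1)) (hsm : 4096 * ((d + 1 : ℕ) : ℝ) * α₁ ≤ 1)
    (a : AfldY (Matrix (Fin N) (Fin N) ℂ) i)
    (ha : ∀ (s : BlkCubeY i c) (ν : Fin (d + 1)) (v : Site (PV d ℓ i.m i.K hd hL) 0), blkOf (cubeFamY i c).toDomains (toBox i.hN v) = s →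
      η * ‖a ν v‖ ≤ α₁ * ((((ℓ + 1) ^ s.1.1 : ℕ) : ℝ))⁻¹) :
    ∀ (z : SiteY i) (nu : BlkCubeY i c → Matrix (Fin N) (Fin N) ℂ),
      ‖(QpsCubeY i c (parKnitCubeY i c) (mulY i (fluct η a) (fun _ _ => 1)) nu - QpsCubeY i c (parKnitCubeY i c) (fun _ _ => 1) nu) z‖ ≤
        CqK d * α₁ * ∑ s, |qpsKc i c z s| * ‖nu s‖ :=
  fun z nu => norm_QpsCubeY_parKnitCubeY_sub_one_apply_le i c hα' hα3 hα4 hη hα₁ hsmall hc₃ hsm a z (ha _) nu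

end Main

end Literature.MathematicalPhysics.QuantumFieldTheory.Balaban1983to89.B9Eq359KnitCubeQDiffAtOne
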